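import Mathlib
import HarnessLib
import Summits.HubbardSuperconductivity.HubbardSuperconductivity.Theorems.KLProgrammeKLRegimeEngineAliasVolume

/-!
# K3 gen-8-FLOW (stmt 20437, stub (C), located item #20, cure (δ′) «LAST-STEP SWAP», layer F3g′): THE VOLUME ARITHMETIC OF THE LAST-STEP ALIAS ROWS —
# the two Gevrey ratios of `lastResponse_bracket_flow_sharp_env`'s symbol tables are `≤ 2^31·((4+Ξ)+Φ)·16^m`, and the order-26 row prices

Cell gate-hubbard-kl, seat p2 g20 («(δ′)-ALIAS-ROWS», step 1).  The scalar symbol rows of `lastResponse_bracket_flow_sharp_env` (p632839) are Gevrey-2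
expressions `P_X·(k!)²·ρ^k` with the two LAST-STEP ratios (weight of the NEXT scale `Λ_{m+1}`, cutoff numerals `X₀ = 5`, `C_χ = 27/10`)
`ρ₃ᴸ = 2(2F_v + 2(4(2(4E_u(1 + 16(1+27/10)/Λ_{m+1}) + F_v))·(1 + (6/Λ_{m+1})(Λ_{m+1}/128 + 5δ))))` and `ρ₄ᴸ = 2ρ₃ᴸ` (`E_u = 4 + 4^mΞ`, `F_v = 2^{10}Φ4^m`,
`δ = Gfr₀|U|Θ16^{−m}`).  This file is the consumer-agnostic arithmetic behind the alias rows `AL_X/AA_X` of the bracket at the registered volume door, in the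
currency of p2 g16's `…EngineAliasVolume`:

* §1 `lastRatio₃_le`, `lastRatio₄_le` — both ratios are `≤ 2^31·((4+Ξ)+Φ)·16^m` under `δ ≤ Λ_{m+1}/4` (so `aliasRatio_mul_two_div_le(_closed)`,
  `aliasRatio_le_sq_beta` apply verbatim: `ρ·(2/N) ≤ U/(2^26β)` per spent derivative at `L ≥ klEngL4Real`, `ρ ≤ 2^22·E·β²`); `lastRatio₃_nonneg`;
* §2 the prefactors: `lastPrefB_le` (`30δ/Λ_{m+1} ≤ 15/2`), `lastPrefA_le` (`30δ²/Λ_{m+1} ≤ 1/64` under the `U`-door value `Gfr₀|U|Θ ≤ 1/512`);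
* §3 the ORDER-26 ROW PRICE: `gevreyRow26_le` — `(26!)²·B⁸·ε¹⁸ ≤ klEngRsq R⁸·U¹⁸/(2^27·β²)` for `B = 2^22·E·β²`, `E ≤ 2^11·klEngRsq R`, `ε = U/(2^26β)`;
  `aliasTerm26_le` — `a·(26!)²·ρ^26·r^{26−j−4} ≤ a·(26!)²·B⁸·ε¹⁸` for `j ≤ 4`, `r ≤ 1` (the `j`-uniform form of `gevreyRow_mul_pow_le`);
* §4 `bellRows_graded_le` — the five Bell rows of a GRADED datum `f i ≤ a·lⁱ` against the sharp curve table (`Dc 1 ≤ 231`, `Dc 2 ≤ 7·10⁵`, `Dc 3 ≤ D·l`,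
  `Dc 4 ≤ D·l²`) are `≤ a·P₄·lᵏ`, `P₄ = 231⁴ + 6·231²·7·10⁵ + 3·(7·10⁵)² + 4·231·D + D` (the datum-`1` rows of `…ResponseInputsSharp` scaled by a graded envelope);
  `far_weight_le` — `L²·Lʲ·(a/(1+L/4)^s) ≤ a·4⁶·(4/L)^{s−6}` for `j ≤ 4`, `10 ≤ s`.

Pure real arithmetic; no definitions; nothing about the model's sizes is asserted; nothing asserts superconductivity.
References: BGM 2006 §2.3 (2.21)–(2.24) [cite: BenfattoGiulianiMastropietro2006].
-/

noncomputable section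

namespace Summit.HubbardSuperconductivity.HubbardSuperconductivity.Theorems.EngineV8

set_option linter.dupNamespace false -- summit = problem name (single-conjunct summit), D-0017

open Real Finset
open Summit.HubbardSuperconductivity.HubbardSuperconductivity.Theorems.KLRegimeSplit
open Summit.HubbardSuperconductivity.HubbardSuperconductivity.Theorems.KLProgrammeLegKernels
open scoped Nat

/-! ## §1 The two last-step ratios are `≤ 2^31·((4+Ξ)+Φ)·16^m` -/

section Ratios

/-- `Λ_{m+1} = (4^m)⁻¹/128`. -/
private theorem klScale_succ_eq (m : ℕ) : (klScale klE0 (m + 1)) = ((4 : ℝ) ^ m)⁻¹ / 128 := by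
  simp only [klScale, klE0, pow_succ, mul_inv]; ring

/-- `0 < Λ_{m+1}`. -/
private theorem klScale_succ_pos (m : ℕ) : 0 < (klScale klE0 (m + 1)) := by rw [klScale_succ_eq]; positivity

/-- `16^m = 4^m·4^m`. -/
private theorem sixteen_pow_eq' (m : ℕ) : (16 : ℝ) ^ m = (4 : ℝ) ^ m * (4 : ℝ) ^ m := by
  rw [← mul_pow]; norm_num

/-- `16·(1 + 27/10)/Λ_{m+1} = (37888/5)·4^m`. -/
private theorem last_band_tw_eq (m : ℕ) : 16 * (1 + (27 / 10 : ℝ)) / (klScale klE0 (m + 1)) = 37888 / 5 * (4 : ℝ) ^ m := by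
  have hinv : ((klScale klE0 (m + 1)))⁻¹ = 128 * (4 : ℝ) ^ m := by
    rw [klScale_succ_eq, inv_div, div_eq_mul_inv, inv_inv]
  rw [div_eq_mul_inv, hinv]; ring

/-- The last-step band block: `4(4 + 4^mΞ)(1 + 16(1+27/10)/Λ_{m+1}) + 2^{10}Φ4^m ≤ 2^{15}·((4+Ξ)+Φ)·16^m`. -/
private theorem last_bandBlock_le {Ξ Φ : ℝ} (hΞ0 : 0 ≤ Ξ) (hΦ0 : 0 ≤ Φ) (m : ℕ) :
    (4 * (4 + (4 : ℝ) ^ m * Ξ) * (1 + 16 * (1 + (27 / 10 : ℝ)) / (klScale klE0 (m + 1)) * 1) + (2 ^ 10 * Φ * (4 : ℝ) ^ m)) ≤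
      2 ^ 15 * ((4 + Ξ) + Φ) * ((4 : ℝ) ^ m * (4 : ℝ) ^ m) := by
  rw [last_band_tw_eq]
  have hA1 : 1 ≤ (4 : ℝ) ^ m := one_le_pow₀ (by norm_num)
  have hA0 : 0 ≤ (4 : ℝ) ^ m := by positivity
  have hAA0 : 0 ≤ (4 : ℝ) ^ m * (4 : ℝ) ^ m := by positivity
  have e1 : (4 : ℝ) ^ m ≤ (4 : ℝ) ^ m * (4 : ℝ) ^ m := by nlinarith
  have e2 : (4 : ℝ) ^ m * Ξ ≤ (4 : ℝ) ^ m * (4 : ℝ) ^ m * Ξ := by nlinarith [mul_nonneg hA0 hΞ0]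
  have e3 : Φ * (4 : ℝ) ^ m ≤ Φ * ((4 : ℝ) ^ m * (4 : ℝ) ^ m) := by nlinarith [mul_nonneg hΦ0 hA0]
  have e4 : (1 : ℝ) ≤ (4 : ℝ) ^ m * (4 : ℝ) ^ m := by nlinarith
  nlinarith [mul_nonneg hA0 hΞ0, mul_nonneg hAA0 hΞ0, mul_nonneg hΦ0 hAA0]

/-- The last-step band block is nonnegative. -/
private theorem last_bandBlock_nonneg {Ξ Φ : ℝ} (hΞ0 : 0 ≤ Ξ) (hΦ0 : 0 ≤ Φ) (m : ℕ) :
    0 ≤ (4 * (4 + (4 : ℝ) ^ m * Ξ) * (1 + 16 * (1 + (27 / 10 : ℝ)) / (klScale klE0 (m + 1)) * 1) + (2 ^ 10 * Φ * (4 : ℝ) ^ m)) := by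
  rw [last_band_tw_eq]
  have hA0 : 0 ≤ (4 : ℝ) ^ m := by positivity
  have := mul_nonneg hA0 hΞ0; have := mul_nonneg hΦ0 hA0
  have : 0 ≤ (4 + (4 : ℝ) ^ m * Ξ) * (1 + 37888 / 5 * (4 : ℝ) ^ m * 1) := mul_nonneg (by linarith) (by nlinarith)
  nlinarith

/-- The last-step dressing block under `δ ≤ Λ_{m+1}/4`: `1 + (6/Λ_{m+1})(Λ_{m+1}/128 + 5δ) ≤ 9`, and it is `≥ 0`. -/
private theorem last_dressBlock_le {R : RenConsts} (hR0 : 0 ≤ R.Gfr 0) {U Θ : ℝ} (hΘ0 : 0 ≤ Θ) (m : ℕ)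
    (hδΛ : (R.Gfr 0 * |U| * Θ * ((16 : ℝ) ^ m)⁻¹) ≤ (klScale klE0 (m + 1)) / 4) :
    (1 + 6 / (klScale klE0 (m + 1)) * ((klScale klE0 (m + 1)) / 128 + (5 : ℝ) * (R.Gfr 0 * |U| * Θ * ((16 : ℝ) ^ m)⁻¹))) ≤ 9 ∧
      0 ≤ (1 + 6 / (klScale klE0 (m + 1)) * ((klScale klE0 (m + 1)) / 128 + (5 : ℝ) * (R.Gfr 0 * |U| * Θ * ((16 : ℝ) ^ m)⁻¹))) := by
  have hΛ0 := klScale_succ_pos m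
  have hΛne : (klScale klE0 (m + 1)) ≠ 0 := hΛ0.ne'
  have hδ0 : 0 ≤ (R.Gfr 0 * |U| * Θ * ((16 : ℝ) ^ m)⁻¹) := mul_nonneg (mul_nonneg (mul_nonneg hR0 (abs_nonneg U)) hΘ0) (by positivity)
  have hDeq : 6 / (klScale klE0 (m + 1)) * ((klScale klE0 (m + 1)) / 128 + (5 : ℝ) * (R.Gfr 0 * |U| * Θ * ((16 : ℝ) ^ m)⁻¹)) =
      6 / 128 + 30 * ((R.Gfr 0 * |U| * Θ * ((16 : ℝ) ^ m)⁻¹) / (klScale klE0 (m + 1))) := by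
    field_simp
    ring
  have hdq : (R.Gfr 0 * |U| * Θ * ((16 : ℝ) ^ m)⁻¹) / (klScale klE0 (m + 1)) ≤ 1 / 4 := by rw [div_le_iff₀ hΛ0]; linarith
  have hdq0 : 0 ≤ (R.Gfr 0 * |U| * Θ * ((16 : ℝ) ^ m)⁻¹) / (klScale klE0 (m + 1)) := div_nonneg hδ0 hΛ0.le
  rw [hDeq]
  constructor <;> linarith

/-- **The last-step ratio `ρ₃ᴸ`** (of the `−J₂` row and of the second `J₁` row of `…LastRespSymbolSupsFlow`, VERBATIM): `ρ₃ᴸ(m) ≤ 2^31·((4+Ξ)+Φ)·16^m`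
under `Gfr₀|U|Θ16^{−m} ≤ Λ_{m+1}/4`. [cite: BenfattoGiulianiMastropietro2006, §2.3 (2.23)] -/
theorem lastRatio₃_le {R : RenConsts} (hR0 : 0 ≤ R.Gfr 0) {U Ξ Θ Φ : ℝ} (hΞ0 : 0 ≤ Ξ) (hΘ0 : 0 ≤ Θ) (hΦ0 : 0 ≤ Φ) (m : ℕ)
    (hδΛ : (R.Gfr 0 * |U| * Θ * ((16 : ℝ) ^ m)⁻¹) ≤ (klScale klE0 (m + 1)) / 4) :
    (2 * (2 * (2 ^ 10 * Φ * (4 : ℝ) ^ m) + 2 * (4 * (2 * (4 * (4 + (4 : ℝ) ^ m * Ξ) * (1 + 16 * (1 + (27 / 10 : ℝ)) / (klScale klE0 (m + 1)) * 1) +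
        (2 ^ 10 * Φ * (4 : ℝ) ^ m))) * (1 + 6 / (klScale klE0 (m + 1)) * ((klScale klE0 (m + 1)) / 128 + (5 : ℝ) * (R.Gfr 0 * |U| * Θ * ((16 : ℝ) ^ m)⁻¹)))))) ≤
      2 ^ 31 * ((4 + Ξ) + Φ) * (16 : ℝ) ^ m := by
  obtain ⟨hD, hD0⟩ := last_dressBlock_le hR0 hΘ0 m hδΛ
  have hT := last_bandBlock_le hΞ0 hΦ0 m
  have hE0 : 0 ≤ ((4 + Ξ) + Φ) := by linarith
  have hA1 : 1 ≤ (4 : ℝ) ^ m := one_le_pow₀ (by norm_num)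
  have hA0 : 0 ≤ (4 : ℝ) ^ m := by positivity
  have hAA0 : 0 ≤ (4 : ℝ) ^ m * (4 : ℝ) ^ m := by positivity
  have hT'0 : 0 ≤ 2 ^ 15 * ((4 + Ξ) + Φ) * ((4 : ℝ) ^ m * (4 : ℝ) ^ m) := mul_nonneg (mul_nonneg (by norm_num) hE0) hAA0
  have hTD : (4 * (4 + (4 : ℝ) ^ m * Ξ) * (1 + 16 * (1 + (27 / 10 : ℝ)) / (klScale klE0 (m + 1)) * 1) + (2 ^ 10 * Φ * (4 : ℝ) ^ m)) *
      (1 + 6 / (klScale klE0 (m + 1)) * ((klScale klE0 (m + 1)) / 128 + (5 : ℝ) * (R.Gfr 0 * |U| * Θ * ((16 : ℝ) ^ m)⁻¹))) ≤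
      (2 ^ 15 * ((4 + Ξ) + Φ) * ((4 : ℝ) ^ m * (4 : ℝ) ^ m)) * 9 := mul_le_mul hT hD hD0 hT'0
  have hF : (2 ^ 10 * Φ * (4 : ℝ) ^ m) ≤ 2 ^ 10 * ((4 + Ξ) + Φ) * ((4 : ℝ) ^ m * (4 : ℝ) ^ m) := by
    have e3 : Φ * (4 : ℝ) ^ m ≤ Φ * ((4 : ℝ) ^ m * (4 : ℝ) ^ m) := by nlinarith [mul_nonneg hΦ0 hA0]
    nlinarith [mul_nonneg hΞ0 hAA0, mul_nonneg hΦ0 hAA0]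
  calc (2 * (2 * (2 ^ 10 * Φ * (4 : ℝ) ^ m) + 2 * (4 * (2 * (4 * (4 + (4 : ℝ) ^ m * Ξ) * (1 + 16 * (1 + (27 / 10 : ℝ)) / (klScale klE0 (m + 1)) * 1) +
        (2 ^ 10 * Φ * (4 : ℝ) ^ m))) * (1 + 6 / (klScale klE0 (m + 1)) * ((klScale klE0 (m + 1)) / 128 + (5 : ℝ) * (R.Gfr 0 * |U| * Θ * ((16 : ℝ) ^ m)⁻¹))))))
      = 4 * (2 ^ 10 * Φ * (4 : ℝ) ^ m) + 32 * ((4 * (4 + (4 : ℝ) ^ m * Ξ) * (1 + 16 * (1 + (27 / 10 : ℝ)) / (klScale klE0 (m + 1)) * 1) +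
          (2 ^ 10 * Φ * (4 : ℝ) ^ m)) * (1 + 6 / (klScale klE0 (m + 1)) * ((klScale klE0 (m + 1)) / 128 + (5 : ℝ) * (R.Gfr 0 * |U| * Θ * ((16 : ℝ) ^ m)⁻¹)))) := by
        ring
    _ ≤ 4 * (2 ^ 10 * ((4 + Ξ) + Φ) * ((4 : ℝ) ^ m * (4 : ℝ) ^ m)) + 32 * ((2 ^ 15 * ((4 + Ξ) + Φ) * ((4 : ℝ) ^ m * (4 : ℝ) ^ m)) * 9) := by linarith
    _ ≤ 2 ^ 31 * ((4 + Ξ) + Φ) * ((4 : ℝ) ^ m * (4 : ℝ) ^ m) := by nlinarith [mul_nonneg hE0 hAA0]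
    _ = 2 ^ 31 * ((4 + Ξ) + Φ) * (16 : ℝ) ^ m := by rw [sixteen_pow_eq']

/-- `0 ≤ ρ₃ᴸ(m)`. -/
theorem lastRatio₃_nonneg {R : RenConsts} (hR0 : 0 ≤ R.Gfr 0) {U Ξ Θ Φ : ℝ} (hΞ0 : 0 ≤ Ξ) (hΘ0 : 0 ≤ Θ) (hΦ0 : 0 ≤ Φ) (m : ℕ)
    (hδΛ : (R.Gfr 0 * |U| * Θ * ((16 : ℝ) ^ m)⁻¹) ≤ (klScale klE0 (m + 1)) / 4) :
    0 ≤ (2 * (2 * (2 ^ 10 * Φ * (4 : ℝ) ^ m) + 2 * (4 * (2 * (4 * (4 + (4 : ℝ) ^ m * Ξ) * (1 + 16 * (1 + (27 / 10 : ℝ)) / (klScale klE0 (m + 1)) * 1) +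
        (2 ^ 10 * Φ * (4 : ℝ) ^ m))) * (1 + 6 / (klScale klE0 (m + 1)) * ((klScale klE0 (m + 1)) / 128 + (5 : ℝ) * (R.Gfr 0 * |U| * Θ * ((16 : ℝ) ^ m)⁻¹)))))) := by
  obtain ⟨-, hD0⟩ := last_dressBlock_le hR0 hΘ0 m hδΛ
  have hB0 := last_bandBlock_nonneg hΞ0 hΦ0 m
  have hA0 : 0 ≤ (4 : ℝ) ^ m := by positivity
  have hF0 : 0 ≤ (2 ^ 10 * Φ * (4 : ℝ) ^ m) := by positivity
  have := mul_nonneg (mul_nonneg (by norm_num : (0 : ℝ) ≤ 4) (mul_nonneg (by norm_num : (0 : ℝ) ≤ 2) hB0)) hD0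
  positivity

/-- **The last-step ratio `ρ₄ᴸ = 2ρ₃ᴸ`** (of the first `J₁` row): `2·ρ₃ᴸ(m) ≤ 2^31·((4+Ξ)+Φ)·16^m` as well (`ρ₃ᴸ ≤ 2^30·…`).
[cite: BenfattoGiulianiMastropietro2006, §2.3 (2.23)] -/
theorem lastRatio₄_le {R : RenConsts} (hR0 : 0 ≤ R.Gfr 0) {U Ξ Θ Φ : ℝ} (hΞ0 : 0 ≤ Ξ) (hΘ0 : 0 ≤ Θ) (hΦ0 : 0 ≤ Φ) (m : ℕ)
    (hδΛ : (R.Gfr 0 * |U| * Θ * ((16 : ℝ) ^ m)⁻¹) ≤ (klScale klE0 (m + 1)) / 4) :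
    (2 * (2 * (2 * (2 ^ 10 * Φ * (4 : ℝ) ^ m) + 2 * (4 * (2 * (4 * (4 + (4 : ℝ) ^ m * Ξ) * (1 + 16 * (1 + (27 / 10 : ℝ)) / (klScale klE0 (m + 1)) * 1) +
        (2 ^ 10 * Φ * (4 : ℝ) ^ m))) * (1 + 6 / (klScale klE0 (m + 1)) * ((klScale klE0 (m + 1)) / 128 + (5 : ℝ) * (R.Gfr 0 * |U| * Θ * ((16 : ℝ) ^ m)⁻¹))))))) ≤
      2 ^ 31 * ((4 + Ξ) + Φ) * (16 : ℝ) ^ m := by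
  obtain ⟨hD, hD0⟩ := last_dressBlock_le hR0 hΘ0 m hδΛ
  have hT := last_bandBlock_le hΞ0 hΦ0 m
  have hE0 : 0 ≤ ((4 + Ξ) + Φ) := by linarith
  have hA1 : 1 ≤ (4 : ℝ) ^ m := one_le_pow₀ (by norm_num)
  have hA0 : 0 ≤ (4 : ℝ) ^ m := by positivity
  have hAA0 : 0 ≤ (4 : ℝ) ^ m * (4 : ℝ) ^ m := by positivity
  have hT'0 : 0 ≤ 2 ^ 15 * ((4 + Ξ) + Φ) * ((4 : ℝ) ^ m * (4 : ℝ) ^ m) := mul_nonneg (mul_nonneg (by norm_num) hE0) hAA0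
  have hTD : (4 * (4 + (4 : ℝ) ^ m * Ξ) * (1 + 16 * (1 + (27 / 10 : ℝ)) / (klScale klE0 (m + 1)) * 1) + (2 ^ 10 * Φ * (4 : ℝ) ^ m)) *
      (1 + 6 / (klScale klE0 (m + 1)) * ((klScale klE0 (m + 1)) / 128 + (5 : ℝ) * (R.Gfr 0 * |U| * Θ * ((16 : ℝ) ^ m)⁻¹))) ≤
      (2 ^ 15 * ((4 + Ξ) + Φ) * ((4 : ℝ) ^ m * (4 : ℝ) ^ m)) * 9 := mul_le_mul hT hD hD0 hT'0
  have hF : (2 ^ 10 * Φ * (4 : ℝ) ^ m) ≤ 2 ^ 10 * ((4 + Ξ) + Φ) * ((4 : ℝ) ^ m * (4 : ℝ) ^ m) := by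
    have e3 : Φ * (4 : ℝ) ^ m ≤ Φ * ((4 : ℝ) ^ m * (4 : ℝ) ^ m) := by nlinarith [mul_nonneg hΦ0 hA0]
    nlinarith [mul_nonneg hΞ0 hAA0, mul_nonneg hΦ0 hAA0]
  calc (2 * (2 * (2 * (2 ^ 10 * Φ * (4 : ℝ) ^ m) + 2 * (4 * (2 * (4 * (4 + (4 : ℝ) ^ m * Ξ) * (1 + 16 * (1 + (27 / 10 : ℝ)) / (klScale klE0 (m + 1)) * 1) +
        (2 ^ 10 * Φ * (4 : ℝ) ^ m))) * (1 + 6 / (klScale klE0 (m + 1)) * ((klScale klE0 (m + 1)) / 128 + (5 : ℝ) * (R.Gfr 0 * |U| * Θ * ((16 : ℝ) ^ m)⁻¹)))))))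
      = 8 * (2 ^ 10 * Φ * (4 : ℝ) ^ m) + 64 * ((4 * (4 + (4 : ℝ) ^ m * Ξ) * (1 + 16 * (1 + (27 / 10 : ℝ)) / (klScale klE0 (m + 1)) * 1) +
          (2 ^ 10 * Φ * (4 : ℝ) ^ m)) * (1 + 6 / (klScale klE0 (m + 1)) * ((klScale klE0 (m + 1)) / 128 + (5 : ℝ) * (R.Gfr 0 * |U| * Θ * ((16 : ℝ) ^ m)⁻¹)))) := by
        ring
    _ ≤ 8 * (2 ^ 10 * ((4 + Ξ) + Φ) * ((4 : ℝ) ^ m * (4 : ℝ) ^ m)) + 64 * ((2 ^ 15 * ((4 + Ξ) + Φ) * ((4 : ℝ) ^ m * (4 : ℝ) ^ m)) * 9) := by linarith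
    _ ≤ 2 ^ 31 * ((4 + Ξ) + Φ) * ((4 : ℝ) ^ m * (4 : ℝ) ^ m) := by nlinarith [mul_nonneg hE0 hAA0]
    _ = 2 ^ 31 * ((4 + Ξ) + Φ) * (16 : ℝ) ^ m := by rw [sixteen_pow_eq']

end Ratios

/-! ## §2 The prefactors of the symbol rows -/

/-- **`P_b = 30δ/Λ_{m+1} ≤ 15/2`** (the prefactor of the `J₁`/`−i·J₁` rows; `c = βL² ≠ 0`), under `δ ≤ Λ_{m+1}/4`; and `0 ≤ P_b`.
[cite: BenfattoGiulianiMastropietro2006, §2.3 (2.23)] -/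
theorem lastPrefB_le {R : RenConsts} (hR0 : 0 ≤ R.Gfr 0) {U Θ c : ℝ} (hc : c ≠ 0) (hΘ0 : 0 ≤ Θ) (m : ℕ)
    (hδΛ : (R.Gfr 0 * |U| * Θ * ((16 : ℝ) ^ m)⁻¹) ≤ (klScale klE0 (m + 1)) / 4) :
    (R.Gfr 0 * |U| * Θ * ((16 : ℝ) ^ m)⁻¹) / |c| * ((5 : ℝ) * (|c| * (6 / (klScale klE0 (m + 1))))) ≤ 15 / 2 ∧
      0 ≤ (R.Gfr 0 * |U| * Θ * ((16 : ℝ) ^ m)⁻¹) / |c| * ((5 : ℝ) * (|c| * (6 / (klScale klE0 (m + 1))))) := by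
  have hΛ0 := klScale_succ_pos m
  have hca : 0 < |c| := abs_pos.2 hc
  have hδ0 : 0 ≤ (R.Gfr 0 * |U| * Θ * ((16 : ℝ) ^ m)⁻¹) := mul_nonneg (mul_nonneg (mul_nonneg hR0 (abs_nonneg U)) hΘ0) (by positivity)
  have heq : (R.Gfr 0 * |U| * Θ * ((16 : ℝ) ^ m)⁻¹) / |c| * ((5 : ℝ) * (|c| * (6 / (klScale klE0 (m + 1))))) =
      30 * ((R.Gfr 0 * |U| * Θ * ((16 : ℝ) ^ m)⁻¹) / (klScale klE0 (m + 1))) := by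
    field_simp
    ring
  have hdq : (R.Gfr 0 * |U| * Θ * ((16 : ℝ) ^ m)⁻¹) / (klScale klE0 (m + 1)) ≤ 1 / 4 := by rw [div_le_iff₀ hΛ0]; linarith
  have hdq0 : 0 ≤ (R.Gfr 0 * |U| * Θ * ((16 : ℝ) ^ m)⁻¹) / (klScale klE0 (m + 1)) := div_nonneg hδ0 hΛ0.le
  rw [heq]
  constructor <;> linarith

/-- **`P_a = 30δ²/Λ_{m+1} ≤ 1/64`** (the prefactor of the `−J₂` row) under `δ ≤ Λ_{m+1}/4` and the `U`-door value `Gfr₀|U|Θ ≤ 1/512`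
(`P_a ≤ (15/2)·δ ≤ (15/2)·Gfr₀|U|Θ`); and `0 ≤ P_a`. [cite: BenfattoGiulianiMastropietro2006, §2.3 (2.23)] -/
theorem lastPrefA_le {R : RenConsts} (hR0 : 0 ≤ R.Gfr 0) {U Θ c : ℝ} (hc : c ≠ 0) (hΘ0 : 0 ≤ Θ) (m : ℕ)
    (hδΛ : (R.Gfr 0 * |U| * Θ * ((16 : ℝ) ^ m)⁻¹) ≤ (klScale klE0 (m + 1)) / 4) (hT : R.Gfr 0 * |U| * Θ ≤ 1 / 512) :
    (R.Gfr 0 * |U| * Θ * ((16 : ℝ) ^ m)⁻¹) * (R.Gfr 0 * |U| * Θ * ((16 : ℝ) ^ m)⁻¹) / |c| * ((5 : ℝ) * (|c| * (6 / (klScale klE0 (m + 1))))) ≤ 1 / 64 ∧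
      0 ≤ (R.Gfr 0 * |U| * Θ * ((16 : ℝ) ^ m)⁻¹) * (R.Gfr 0 * |U| * Θ * ((16 : ℝ) ^ m)⁻¹) / |c| * ((5 : ℝ) * (|c| * (6 / (klScale klE0 (m + 1))))) := by
  have hΛ0 := klScale_succ_pos m
  have hca : 0 < |c| := abs_pos.2 hc
  have hT0 : 0 ≤ R.Gfr 0 * |U| * Θ := mul_nonneg (mul_nonneg hR0 (abs_nonneg U)) hΘ0
  have hδ0 : 0 ≤ (R.Gfr 0 * |U| * Θ * ((16 : ℝ) ^ m)⁻¹) := mul_nonneg hT0 (by positivity)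
  have hδT : (R.Gfr 0 * |U| * Θ * ((16 : ℝ) ^ m)⁻¹) ≤ 1 / 512 := by
    have h16 : ((16 : ℝ) ^ m)⁻¹ ≤ 1 := inv_le_one_of_one_le₀ (one_le_pow₀ (by norm_num))
    calc (R.Gfr 0 * |U| * Θ * ((16 : ℝ) ^ m)⁻¹) ≤ R.Gfr 0 * |U| * Θ * 1 := mul_le_mul_of_nonneg_left h16 hT0
      _ ≤ 1 / 512 := by linarith
  have heq : (R.Gfr 0 * |U| * Θ * ((16 : ℝ) ^ m)⁻¹) * (R.Gfr 0 * |U| * Θ * ((16 : ℝ) ^ m)⁻¹) / |c| * ((5 : ℝ) * (|c| * (6 / (klScale klE0 (m + 1))))) =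
      30 * (R.Gfr 0 * |U| * Θ * ((16 : ℝ) ^ m)⁻¹) * ((R.Gfr 0 * |U| * Θ * ((16 : ℝ) ^ m)⁻¹) / (klScale klE0 (m + 1))) := by
    field_simp
    ring
  have hdq : (R.Gfr 0 * |U| * Θ * ((16 : ℝ) ^ m)⁻¹) / (klScale klE0 (m + 1)) ≤ 1 / 4 := by rw [div_le_iff₀ hΛ0]; linarith
  have hdq0 : 0 ≤ (R.Gfr 0 * |U| * Θ * ((16 : ℝ) ^ m)⁻¹) / (klScale klE0 (m + 1)) := div_nonneg hδ0 hΛ0.le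
  rw [heq]
  constructor
  · nlinarith [mul_nonneg hδ0 hdq0]
  · positivity

/-! ## §3 The order-26 row price -/

/-- **The `j`-uniform Gevrey-row bound at `Mg = 26`**: `a·(26!)²·ρ^26·r^{26−j−4} ≤ a·(26!)²·B⁸·ε¹⁸` for `j ≤ 4`, from `ρ·r ≤ ε`, `ρ ≤ B`, `0 ≤ r ≤ 1`.
[cite: BenfattoGiulianiMastropietro2006, §2.3 (2.24)] -/
theorem aliasTerm26_le {a ρ r ε B : ℝ} (ha : 0 ≤ a) (hρ0 : 0 ≤ ρ) (hr0 : 0 ≤ r) (hr1 : r ≤ 1) (hρr : ρ * r ≤ ε) (hρB : ρ ≤ B)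
    {j : ℕ} (hj : j ≤ 4) :
    a * ((26 ! : ℝ)) ^ 2 * ρ ^ 26 * r ^ (26 - j - 4) ≤ a * ((26 ! : ℝ)) ^ 2 * B ^ 8 * ε ^ 18 := by
  have h1 : r ^ (26 - j - 4) ≤ r ^ 18 := pow_le_pow_of_le_one hr0 hr1 (by omega)
  have h3 : ρ ^ 8 ≤ B ^ 8 := pow_le_pow_left₀ hρ0 hρB 8
  have h4 : (ρ * r) ^ 18 ≤ ε ^ 18 := pow_le_pow_left₀ (mul_nonneg hρ0 hr0) hρr 18
  have ha2 : 0 ≤ a * ((26 ! : ℝ)) ^ 2 := by positivity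
  calc a * ((26 ! : ℝ)) ^ 2 * ρ ^ 26 * r ^ (26 - j - 4) ≤ a * ((26 ! : ℝ)) ^ 2 * ρ ^ 26 * r ^ 18 :=
        mul_le_mul_of_nonneg_left h1 (by positivity)
    _ = a * ((26 ! : ℝ)) ^ 2 * (ρ ^ 8 * (ρ * r) ^ 18) := by ring
    _ ≤ a * ((26 ! : ℝ)) ^ 2 * (B ^ 8 * ε ^ 18) :=
        mul_le_mul_of_nonneg_left (mul_le_mul h3 h4 (by positivity) ((pow_nonneg hρ0 8).trans h3)) ha2
    _ = a * ((26 ! : ℝ)) ^ 2 * B ^ 8 * ε ^ 18 := by ring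

/-- **THE ORDER-26 ROW PRICE**: with `B = 2^22·E·β²` (`aliasRatio_le_sq_beta`), `E ≤ 2^11·klEngRsq R` (`envelopeE_le`) and `ε = U/(2^26·β)`
(`aliasRatio_mul_two_div_le_closed`): `(26!)²·B⁸·ε¹⁸ ≤ klEngRsq R⁸·U¹⁸/(2^27·β²)` (`(26!)² ≤ 2^177`, `klBetaMin ≤ β`).
[cite: BenfattoGiulianiMastropietro2006, §2.3 (2.24)] -/
theorem gevreyRow26_le {R : RenConsts} {β U E : ℝ} (hβ : klBetaMin ≤ β) (hE0 : 0 ≤ E) (hE : E ≤ 2 ^ 11 * klEngRsq R) :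
    ((26 ! : ℝ)) ^ 2 * (2 ^ 22 * E * β ^ 2) ^ 8 * (U / (2 ^ 26 * β)) ^ 18 ≤ klEngRsq R ^ 8 * U ^ 18 / (2 ^ 27 * β ^ 2) := by
  have h128 : (128 : ℝ) ≤ β := by simpa [klBetaMin] using hβ
  have hβ0 : (0 : ℝ) < β := by linarith
  have hfac : ((26 ! : ℝ)) ^ 2 ≤ 2 ^ 177 := by norm_num [Nat.factorial]
  have hE8 : E ^ 8 ≤ (2 ^ 11 * klEngRsq R) ^ 8 := pow_le_pow_left₀ hE0 hE 8
  -- `(2^26)^18 = 2^176·2^146·2^146` and `(2^22)^8 = 2^176` (exponents kept below the evaluation threshold)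
  have heq : ((26 ! : ℝ)) ^ 2 * (2 ^ 22 * E * β ^ 2) ^ 8 * (U / (2 ^ 26 * β)) ^ 18 =
      (((26 ! : ℝ)) ^ 2 * E ^ 8 / (2 ^ 146 * 2 ^ 146)) * (U ^ 18 / β ^ 2) := by
    rw [div_pow, mul_pow, mul_pow]
    field_simp
  have heq2 : klEngRsq R ^ 8 * U ^ 18 / (2 ^ 27 * β ^ 2) = (klEngRsq R ^ 8 / 2 ^ 27) * (U ^ 18 / β ^ 2) := by
    rw [mul_comm (2 ^ 27 : ℝ) (β ^ 2), ← div_div, mul_div_assoc, div_mul_eq_mul_div, mul_div_assoc]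
  rw [heq, heq2]
  refine mul_le_mul_of_nonneg_right ?_ (by positivity)
  rw [div_le_div_iff₀ (by positivity) (by positivity)]
  calc ((26 ! : ℝ)) ^ 2 * E ^ 8 * 2 ^ 27 ≤ 2 ^ 177 * (2 ^ 11 * klEngRsq R) ^ 8 * 2 ^ 27 := by gcongr
    _ = klEngRsq R ^ 8 * (2 ^ 146 * 2 ^ 146) := by ring

/-! ## §4 Graded Bell rows against the sharp curve table, and the far-moment weight -/

/-- Monotonicity of a triple product of nonnegative reals. -/
private theorem mul3_le {x X y Y z Z : ℝ} (hx0 : 0 ≤ x) (hx : x ≤ X) (hy0 : 0 ≤ y) (hy : y ≤ Y) (hz0 : 0 ≤ z) (hz : z ≤ Z) :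
    x * y * z ≤ X * Y * Z :=
  mul_le_mul (mul_le_mul hx hy hy0 (hx0.trans hx)) hz hz0 (mul_nonneg (hx0.trans hx) (hy0.trans hy))

/-- **GRADED BELL ROWS**: a datum `0 ≤ f i ≤ a·lⁱ` (`i ≤ 4`) against a curve table `0 ≤ Dc i`, `Dc 1 ≤ 231`, `Dc 2 ≤ 7·10⁵`, `Dc 3 ≤ D·l`, `Dc 4 ≤ D·l²`
(`1 ≤ l`, `1 ≤ D`) has its five Bell rows `≤ a·P₄·lᵏ`, `P₄ = 231⁴ + 6·231²·7·10⁵ + 3·(7·10⁵)² + 4·231·D + D`.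
[cite: BenfattoGiulianiMastropietro2006, §2.4 (2.36)–(2.42)] -/
theorem bellRows_graded_le {f Dc : ℕ → ℝ} {a l D : ℝ} (hl1 : 1 ≤ l) (ha : 0 ≤ a) (hD : 1 ≤ D)
    (hf0 : ∀ i ≤ 4, 0 ≤ f i) (hf : ∀ i ≤ 4, f i ≤ a * l ^ i) (hDc0 : ∀ i, 1 ≤ i → i ≤ 4 → 0 ≤ Dc i)
    (hDc1 : Dc 1 ≤ 231) (hDc2 : Dc 2 ≤ 700000) (hDc3 : Dc 3 ≤ D * l) (hDc4 : Dc 4 ≤ D * l ^ 2) :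
    f 0 ≤ a * ((231 : ℝ) ^ 4 + 6 * 231 ^ 2 * 700000 + 3 * 700000 ^ 2 + 4 * 231 * D + D) * l ^ 0 ∧
    f 1 * Dc 1 ≤ a * ((231 : ℝ) ^ 4 + 6 * 231 ^ 2 * 700000 + 3 * 700000 ^ 2 + 4 * 231 * D + D) * l ^ 1 ∧
    f 2 * Dc 1 ^ 2 + f 1 * Dc 2 ≤ a * ((231 : ℝ) ^ 4 + 6 * 231 ^ 2 * 700000 + 3 * 700000 ^ 2 + 4 * 231 * D + D) * l ^ 2 ∧
    f 3 * Dc 1 ^ 3 + 3 * f 2 * Dc 1 * Dc 2 + f 1 * Dc 3 ≤ a * ((231 : ℝ) ^ 4 + 6 * 231 ^ 2 * 700000 + 3 * 700000 ^ 2 + 4 * 231 * D + D) * l ^ 3 ∧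
    f 4 * Dc 1 ^ 4 + 6 * f 3 * Dc 1 ^ 2 * Dc 2 + 3 * f 2 * Dc 2 ^ 2 + 4 * f 2 * Dc 1 * Dc 3 + f 1 * Dc 4 ≤
      a * ((231 : ℝ) ^ 4 + 6 * 231 ^ 2 * 700000 + 3 * 700000 ^ 2 + 4 * 231 * D + D) * l ^ 4 := by
  have d1 := hDc0 1 le_rfl (by norm_num); have d2 := hDc0 2 (by norm_num) (by norm_num)
  have d3 := hDc0 3 (by norm_num) (by norm_num); have d4 := hDc0 4 (by norm_num) le_rfl
  have f1 := hf 1 (by norm_num); have f2 := hf 2 (by norm_num); have f3 := hf 3 (by norm_num); have f4 := hf 4 le_rfl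
  have g2 := hf0 2 (by norm_num); have g3 := hf0 3 (by norm_num)
  have hl0 : 0 ≤ l := zero_le_one.trans hl1
  have hD0 : 0 ≤ D := zero_le_one.trans hD
  have haD : 0 ≤ a * D := mul_nonneg ha hD0
  have hm : ∀ i j : ℕ, i ≤ j → a * l ^ i ≤ a * l ^ j := fun i j hij => mul_le_mul_of_nonneg_left (pow_le_pow_right₀ hl1 hij) ha
  have hn : ∀ i j : ℕ, i ≤ j → a * D * l ^ i ≤ a * D * l ^ j := fun i j hij => mul_le_mul_of_nonneg_left (pow_le_pow_right₀ hl1 hij) haD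
  have m0 : ∀ i : ℕ, 0 ≤ a * l ^ i := fun i => mul_nonneg ha (pow_nonneg hl0 i)
  have n0 : ∀ i : ℕ, 0 ≤ a * D * l ^ i := fun i => mul_nonneg haD (pow_nonneg hl0 i)
  -- monomial bounds (all in the atoms `a·lⁱ`, `a·D·lⁱ`)
  have p11 : f 1 * Dc 1 ≤ a * l ^ 1 * 231 := mul_le_mul f1 hDc1 d1 (m0 1)
  have p21 : f 2 * Dc 1 ^ 2 ≤ a * l ^ 2 * 231 ^ 2 := mul_le_mul f2 (pow_le_pow_left₀ d1 hDc1 2) (by positivity) (m0 2)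
  have p22 : f 1 * Dc 2 ≤ a * l ^ 1 * 700000 := mul_le_mul f1 hDc2 d2 (m0 1)
  have p31 : f 3 * Dc 1 ^ 3 ≤ a * l ^ 3 * 231 ^ 3 := mul_le_mul f3 (pow_le_pow_left₀ d1 hDc1 3) (by positivity) (m0 3)
  have p32 : f 2 * Dc 1 * Dc 2 ≤ a * l ^ 2 * 231 * 700000 := mul3_le g2 f2 d1 hDc1 d2 hDc2
  have p33 : f 1 * Dc 3 ≤ a * D * l ^ 2 := (mul_le_mul f1 hDc3 d3 (m0 1)).trans (le_of_eq (by ring))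
  have p41 : f 4 * Dc 1 ^ 4 ≤ a * l ^ 4 * 231 ^ 4 := mul_le_mul f4 (pow_le_pow_left₀ d1 hDc1 4) (by positivity) (m0 4)
  have p42 : f 3 * Dc 1 ^ 2 * Dc 2 ≤ a * l ^ 3 * 231 ^ 2 * 700000 := mul3_le g3 f3 (pow_nonneg d1 2) (pow_le_pow_left₀ d1 hDc1 2) d2 hDc2
  have p43 : f 2 * Dc 2 ^ 2 ≤ a * l ^ 2 * 700000 ^ 2 := mul_le_mul f2 (pow_le_pow_left₀ d2 hDc2 2) (by positivity) (m0 2)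
  have p44 : f 2 * Dc 1 * Dc 3 ≤ 231 * (a * D * l ^ 3) := (mul3_le g2 f2 d1 hDc1 d3 hDc3).trans (le_of_eq (by ring))
  have p45 : f 1 * Dc 4 ≤ a * D * l ^ 3 := (mul_le_mul f1 hDc4 d4 (m0 1)).trans (le_of_eq (by ring))
  have q1 := hm 1 2 (by norm_num); have q2 := hm 1 3 (by norm_num); have q3 := hm 2 3 (by norm_num)
  have q4 := hm 2 4 (by norm_num); have q5 := hm 3 4 (by norm_num); have q6 := hn 2 3 (by norm_num); have q7 := hn 3 4 (by norm_num)
  have z0 := m0 0; have z1 := m0 1; have z2 := m0 2; have z3 := m0 3; have z4 := m0 4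
  have y0 := n0 0; have y1 := n0 1; have y2 := n0 2; have y3 := n0 3; have y4 := n0 4
  refine ⟨?_, ?_, ?_, ?_, ?_⟩
  · linarith [hf 0 (by norm_num)]
  · linarith
  · linarith
  · linarith
  · linarith

/-- **The far-moment weight of the alias rows**: `L²·Lʲ·(A·(M/(1+L/4)^s)) ≤ A·M·4⁶·(4/L)^{s−6}` for `j ≤ 4`, `6 ≤ s`, `4 ≤ L`, `A, M ≥ 0`.
[cite: BenfattoGiulianiMastropietro2006, §2.3 (2.24)] -/
theorem far_weight_le {L : ℕ} (hL : 4 ≤ L) {A Mo : ℝ} (hA : 0 ≤ A) (hM : 0 ≤ Mo) {j s : ℕ} (hj : j ≤ 4) (hs : 6 ≤ s) :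
    (L : ℝ) ^ 2 * (L : ℝ) ^ j * (A * (Mo / (1 + (L : ℝ) / 4) ^ s)) ≤ A * Mo * 4 ^ 6 * (4 / (L : ℝ)) ^ (s - 6) := by
  have hL0 : 0 < L := by omega
  have hLr : (4 : ℝ) ≤ L := by exact_mod_cast hL
  have hLpos : (0 : ℝ) < L := by linarith
  have hq1 : 4 / (L : ℝ) ≤ 1 := by rw [div_le_one hLpos]; exact hLr
  have hq0 : 0 ≤ 4 / (L : ℝ) := by positivity
  have h1 : Mo / (1 + (L : ℝ) / 4) ^ s ≤ Mo * (4 / (L : ℝ)) ^ s := div_one_add_quarter_pow_le hL0 hM s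
  obtain ⟨t, rfl⟩ : ∃ t, s = j + 2 + t := ⟨s - (j + 2), by omega⟩
  have ht : j + 2 + t - 6 = t - (4 - j) := by omega
  have hpow : (L : ℝ) ^ 2 * (L : ℝ) ^ j * (4 / (L : ℝ)) ^ (j + 2 + t) = 4 ^ (j + 2) * (4 / (L : ℝ)) ^ t := by
    rw [pow_add, div_pow, ← pow_add, add_comm 2 j]
    field_simp
  have h4j : (4 : ℝ) ^ (j + 2) ≤ 4 ^ 6 := pow_le_pow_right₀ (by norm_num) (by omega)
  have hqt : (4 / (L : ℝ)) ^ t ≤ (4 / (L : ℝ)) ^ (j + 2 + t - 6) := by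
    rw [ht]; exact pow_le_pow_of_le_one hq0 hq1 (by omega)
  calc (L : ℝ) ^ 2 * (L : ℝ) ^ j * (A * (Mo / (1 + (L : ℝ) / 4) ^ (j + 2 + t)))
      ≤ (L : ℝ) ^ 2 * (L : ℝ) ^ j * (A * (Mo * (4 / (L : ℝ)) ^ (j + 2 + t))) := by gcongr
    _ = A * Mo * ((L : ℝ) ^ 2 * (L : ℝ) ^ j * (4 / (L : ℝ)) ^ (j + 2 + t)) := by ring
    _ = A * Mo * (4 ^ (j + 2) * (4 / (L : ℝ)) ^ t) := by rw [hpow]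
    _ ≤ A * Mo * (4 ^ 6 * (4 / (L : ℝ)) ^ (j + 2 + t - 6)) :=
        mul_le_mul_of_nonneg_left (mul_le_mul h4j hqt (by positivity) (by positivity)) (mul_nonneg hA hM)
    _ = A * Mo * 4 ^ 6 * (4 / (L : ℝ)) ^ (j + 2 + t - 6) := by ring

end Summit.HubbardSuperconductivity.HubbardSuperconductivity.Theorems.EngineV8

end
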